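import Summits.HodgeConjecture.CorCM.Census.DecicCurveFivefoldPowers
import Summits.HodgeConjecture.CorCM.DihedralSexticPairWeights
import Summits.HodgeConjecture.CorCM.DihedralSexticPairFrameTransfer
import Summits.HodgeConjecture.CorCM.DihedralSexticPairCurvePowersTransfer
import HarnessLib

/-!
# COR-CM — `B₀ × E` for a cyclic decic CM field `F ⊃ k` (half-circle CM fivefold × CM curve): FRAME TRANSFER — Galois-balanced
# weights of every power are model-balanced, and the generating weights (conjugate pairs, `k`-Weil `6`-sets) have algebraic
# lines GIVEN the Weil plane of the sixfold

Cell `pub-hodgecm2` (COR-CM), seat b09 gen 18 (2026-08-21); count-neutral own lane DECIC-EB0 (lit-andre-3's prover-lane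
ask A6-R22 «HC(E^a × B₀^b) for cyclic decic F on the real carriers»); no named fact, no `sorry` (two auxiliary definitions:
the slot map and the model map, as in seat b30's `CorCM/DihedralSexticPairCurveTransfer.lean`, whose pattern this file follows
at degree `10`).  Consumed by `CorCM/DecicCurveFivefoldPowersTransfer.lean` (assembly for all powers).

SETTING.  A family of CM fields `Kf : I → Type`, indices `i₀` (the quadratic field `k = Kf i₀`, `τ : k → ℂ`) and `i₁`
(the decic field `F = Kf i₁`, `i : k → F`); two slots `curveSlots₂ i₀ i₁ = (i₁, i₀)` (`Fin.cons`, so that slot `1` is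
DEFINITIONALLY `i₀`; the fivefold FIRST, as in Moonen–Zarhin's `X × E_k` and ring 2's `Ring2AbelianAllOddTimesCurve`);
realisations `A₂ j ⊨ (Kf (curveSlots₂ j); Φ₂ j)` — `B₀ = A₂ 0 ⊨ (F; Φ)` with `Φ = {s | e s < 5}` (`hΦ`) read in a
CYCLIC FRAME `e : Hom(F, ℂ) ≃ ℤ/10`, and `E = A₂ 1 ⊨ (k; {τ})` (`hΨ`): `he_gal` (every translation `+g` is realised by an
automorphism of `ℂ`), `he_conj` (complex conjugation is `+5`), `he_sign` (`s|_k = τ` iff `e s` is ODD — then `k` acts on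
`H^{1,0}(B₀ × E)` with multiplicities `(3,3)`: Weil type).  For `F` Galois with cyclic group `⟨σ⟩` of order `10` such a
frame is `e(p ∘ σⁿ) = n` with `p|_k = τ̄` (constructed in `CorCM/DecicCurveFivefoldCyclicFrame.lean`).  A power is
`X = ⨁_j A₂ (κ j)` for an arbitrary slot map `κ : Fin N → Fin 2`; its index set projects to that of `Y = ⨁ A₂` by
`P = Sigma.map κ id` and to the 12-point model by `v = toPt e τ ∘ P` (a CONFIGURATION in the sense of
`Census/DecicCurveFivefoldPowers.lean`; that file's docstring names the slots in the order `(E, B₀)` — immaterial there, the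
model map `v` being slot-agnostic; the slot order fixed HERE is `(B₀, E)`).

* §1 `modelBalanced_of_isGaloisBalancedAlg` — an `Aut(ℂ)`-balanced weight of `X` (Pohlmann's condition for the CM
  algebra `∏_j K_{κ j}`) is a balanced configuration (the ten translations are realised by automorphisms of `ℂ`, which
  fix or conjugate `τ` according to parity: `comp_eq_iff_of_realises`); `toPt_conj_smul`;
* §2 `weightClassesAlg_le_algebraicClasses_of_image_eq_conjPair` (divisor pairs, `PairWeights.…_of_conj_smul_mem`) and
  **`weightClassesAlg_le_algebraicClasses_of_image_eq_weil6`** — a weight of `Y` whose model image is a `k`-Weil `6`-set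
  has all its points in ONE fibre of `Hom(F × k, ℂ) → Hom(k, ℂ)`, so its line lies in the `±i√d`-eigenline
  `E±(⨁ A₂, ι_B(iδ) ⊕ ι_E(δ))` (`PairWeights.weightClassesAlg_le_weilClassesPlus/Minus`), inside the Weil plane of the
  sixfold — algebraic by the HYPOTHESIS `hW` (the Weil plane of `(B₀ × E, iδ × δ)` consists of algebraic classes;
  `PairWeights.weilClassesOf_biproduct_le_algebraicClasses_of_prod`).
HONEST FRAMING: nothing about the Hodge conjecture is concluded here; `HC_CM` is not asserted.
[cite: Pohlmann1968, Thm 1] [cite: GaoUllmo2025, Thm 3.1] [cite: Deligne1982HodgeCycles, §4–§5] [cite: vanGeemen1994HodgeAV, 4.9]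

## References
* [Pohlmann1968] H. Pohlmann, Ann. of Math. 88 (1968), Thm 1.  [GaoUllmo2025] Z. Gao, E. Ullmo, J. Inst. Math. Jussieu 25
  (2025), Thm 3.1.  [Deligne1982HodgeCycles] P. Deligne, LNM 900 (1982), §4 Prop. 4.4, §5 (c).  [vanGeemen1994HodgeAV]
  B. van Geemen, LNM 1594 (1994), 4.9, 6.12.  [Gordon1999HodgeAVSurvey] B. B. Gordon, §9.2.
-/

noncomputable section

open CategoryTheory CategoryTheory.Limits NumberField

namespace Summit.HodgeConjecture.CorCM.DecicCurveFivefold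

open Literature.AlgebraicGeometry Literature.AlgebraicGeometry.Motives Literature.AlgebraicGeometry.HodgeTheory
open Literature.AlgebraicGeometry.ComplexMultiplication (IsCMTypeRealisation)
open Literature.AlgebraicGeometry.Pohlmann1968
open Literature.AlgebraicTopology.SingularHomology
open Literature.NumberTheory.ComplexMultiplication
open Summit.HodgeConjecture.CorCM.Census.DecicCurveFivefold (Pt act phi balanced conjPair weil6 gens act_inl act_inr
  act_five_inl mem_phi_inl mem_phi_inr mem_gens_iff mem_conjPair_iff mem_weil6_true_iff mem_weil6_false_iff isCMType_phi
  gens_balanced)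
open Summit.HodgeConjecture.CorCM.Census.DecicCurveFivefoldPowers (ModelBalanced modelBalanced_induction)
open Summit.HodgeConjecture.CorCM.PairWeights
open Summit.HodgeConjecture.CorCM.DihedralSexticPairCurvePowers (ncard_sep_eq_card_filter)

open scoped Classical Pointwise

/-! ## §0 The slot map and the model map -/

section Defs

variable {I : Type}

/-- The fields of the two slots of `B₀ × E`: `(i₁, i₀)` — `Fin.cons`, so that `curveSlots₂ i₀ i₁ 0` is DEFINITIONALLY
`i₁` (the decic field) and `curveSlots₂ i₀ i₁ 1` is DEFINITIONALLY `i₀` (the quadratic field). [folklore] -/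
def curveSlots₂ (i₀ i₁ : I) : Fin 2 → I := Fin.cons i₁ fun _ : Fin 1 => i₀

variable {Kf : I → Type} [∀ i, Field (Kf i)] {i₀ i₁ : I}

/-- **The model map** `Hom(F × k, ℂ) → Pt`: `(0, s) ↦ inr (e s)`, `(1, σ) ↦ inl [σ = τ]`. [folklore] -/
def toPt (e : (Kf i₁ →+* ℂ) ≃ ZMod 10) (τ : Kf i₀ →+* ℂ) :
    ((j : Fin 2) × (Kf (curveSlots₂ i₀ i₁ j) →+* ℂ)) → Pt := fun x =>
  Fin.cases (motive := fun j => (Kf (curveSlots₂ i₀ i₁ j) →+* ℂ) → Pt)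
    (fun s => Sum.inr (e s)) (fun _ σ => Sum.inl (decide (σ = τ))) x.1 x.2

/-- `toPt` on the fivefold slot. [folklore] -/
@[simp] theorem toPt_zero (e : (Kf i₁ →+* ℂ) ≃ ZMod 10) (τ : Kf i₀ →+* ℂ) (s : Kf i₁ →+* ℂ) :
    toPt e τ ⟨0, s⟩ = Sum.inr (e s) := rfl

/-- `toPt` on the curve slot. [folklore] -/
@[simp] theorem toPt_one (e : (Kf i₁ →+* ℂ) ≃ ZMod 10) (τ : Kf i₀ →+* ℂ) (σ : Kf i₀ →+* ℂ) :
    toPt e τ ⟨(0 : Fin 1).succ, σ⟩ = Sum.inl (decide (σ = τ)) := rfl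

end Defs

/-! ## §1 Frame transfer -/

section Transfer

variable {I : Type} {Kf : I → Type} [∀ i, Field (Kf i)]
  {i₀ i₁ : I} {e : (Kf i₁ →+* ℂ) ≃ ZMod 10} {τ : Kf i₀ →+* ℂ}
  (hττ : ComplexEmbedding.conjugate τ ≠ τ) (hk : ∀ σ : Kf i₀ →+* ℂ, σ = τ ∨ σ = ComplexEmbedding.conjugate τ)

/-- Every point of the index set is `(0, s)` or `(1, σ)`. [folklore] -/
theorem sigma_cases (x : (j : Fin 2) × (Kf (curveSlots₂ i₀ i₁ j) →+* ℂ)) :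
    (∃ s : Kf i₁ →+* ℂ, x = ⟨0, s⟩) ∨ ∃ σ : Kf i₀ →+* ℂ, x = ⟨(0 : Fin 1).succ, σ⟩ := by
  obtain ⟨j, s⟩ := x
  refine Fin.cases ?_ (fun m => ?_) j s
  · exact fun s => Or.inl ⟨s, rfl⟩
  · intro σ
    obtain rfl : m = 0 := Subsingleton.elim m 0
    exact Or.inr ⟨σ, rfl⟩

include hττ hk in
/-- The model map is injective (`Hom(k, ℂ) = {τ, τ̄}`). [folklore] -/
theorem toPt_injective : Function.Injective (toPt (i₀ := i₀) (i₁ := i₁) e τ) := by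
  intro x y hxy
  rcases sigma_cases x with ⟨s, rfl⟩ | ⟨σ, rfl⟩ <;> rcases sigma_cases y with ⟨s', rfl⟩ | ⟨σ', rfl⟩
  · rw [toPt_zero, toPt_zero, Sum.inr.injEq] at hxy
    rw [e.injective hxy]
  · exact absurd hxy (by rw [toPt_zero, toPt_one]; exact Sum.inr_ne_inl)
  · exact absurd hxy (by rw [toPt_zero, toPt_one]; exact Sum.inl_ne_inr)
  · rw [toPt_one, toPt_one, Sum.inl.injEq] at hxy
    rcases hk σ with rfl | rfl <;> rcases hk σ' with rfl | rfl
    · rfl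
    · simp only [decide_true] at hxy; exact absurd (of_decide_eq_true hxy.symm) hττ
    · simp only [decide_true] at hxy; exact absurd (of_decide_eq_true hxy) hττ
    · rfl

variable {i : Kf i₀ →+* Kf i₁}
  (he_sign : ∀ s : Kf i₁ →+* ℂ, s.comp i = τ ↔ (e s).val % 2 = 1)
  (he_conj : ∀ s : Kf i₁ →+* ℂ, e (ComplexEmbedding.conjugate s) = e s + 5)
  (he_gal : ∀ g : ZMod 10, ∃ ρ : ℂ ≃+* ℂ, ∀ s : Kf i₁ →+* ℂ, e ((ρ : ℂ →+* ℂ).comp s) = e s + g)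

/-- Parity in `ℤ/10`: `1 + g` is odd iff `g` is even, and `g + 5` is odd iff `g` is even. [folklore] -/
theorem parity_facts : (∀ g : ZMod 10, (1 + g).val % 2 = 1 ↔ g.val % 2 = 0) ∧
    (∀ g : ZMod 10, (g + 5).val % 2 = 1 ↔ ¬ g.val % 2 = 1) ∧ (∀ g : ZMod 10, g.val % 2 = 0 ↔ ¬ g.val % 2 = 1) := by
  refine ⟨by decide, by decide, by decide⟩

include hk he_sign in
/-- In the frame, an embedding `s` of `F` with `e s` even restricts to `τ̄`. [folklore] -/
theorem comp_eq_conjugate_of_even {s : Kf i₁ →+* ℂ} (hs : ¬ (e s).val % 2 = 1) :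
    s.comp i = ComplexEmbedding.conjugate τ := by
  rcases hk (s.comp i) with h | h
  · exact absurd ((he_sign s).1 h) hs
  · exact h

include hττ hk he_sign in
/-- **How a realiser acts on the curve slot**: if `ρ ∈ Aut(ℂ)` realises the translation `+g` on `Hom(F, ℂ)`, then
`[ρ ∘ σ = τ] = [σ = τ]` for `g` even and `= ¬[σ = τ]` for `g` odd (read on an embedding `s₀` of `F` with `e s₀ = 1`, which
extends `τ`). [cite: Gordon1999HodgeAVSurvey, §9.2] -/
theorem comp_eq_iff_of_realises (ρ : ℂ ≃+* ℂ) {g : ZMod 10}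
    (hρ : ∀ s : Kf i₁ →+* ℂ, e ((ρ : ℂ →+* ℂ).comp s) = e s + g) (σ : Kf i₀ →+* ℂ) :
    (ρ : ℂ →+* ℂ).comp σ = τ ↔ (if g.val % 2 = 0 then decide (σ = τ) else !decide (σ = τ)) = true := by
  -- `ρ ∘ τ = τ ↔ g even`: read on `s₀` with `e s₀ = 1`
  obtain ⟨s₀, hs₀⟩ := e.surjective 1
  have hs₀τ : s₀.comp i = τ := (he_sign s₀).2 (by rw [hs₀]; decide)
  have hρτ : (ρ : ℂ →+* ℂ).comp τ = τ ↔ g.val % 2 = 0 := by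
    have h1 : ((ρ : ℂ →+* ℂ).comp s₀).comp i = τ ↔ (e ((ρ : ℂ →+* ℂ).comp s₀)).val % 2 = 1 := he_sign _
    rw [RingHom.comp_assoc, hs₀τ, hρ s₀, hs₀, parity_facts.1 g] at h1
    exact h1
  -- `ρ` permutes `{τ, τ̄}`
  have hinjρ : ∀ σ₁ σ₂ : Kf i₀ →+* ℂ, (ρ : ℂ →+* ℂ).comp σ₁ = (ρ : ℂ →+* ℂ).comp σ₂ → σ₁ = σ₂ :=
    fun σ₁ σ₂ h => RingHom.ext fun z => ρ.injective (by
      have e1 := RingHom.congr_fun h z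
      simp only [RingHom.coe_comp, RingHom.coe_coe, Function.comp_apply] at e1
      exact e1)
  have hρ2 : (ρ : ℂ →+* ℂ).comp (ComplexEmbedding.conjugate τ) = τ ↔ ¬ (ρ : ℂ →+* ℂ).comp τ = τ := by
    constructor
    · intro h1 h2
      exact hττ (hinjρ _ _ (h1.trans h2.symm))
    · intro h1
      rcases hk ((ρ : ℂ →+* ℂ).comp (ComplexEmbedding.conjugate τ)) with h2 | h2
      · exact h2
      · exfalso
        rcases hk ((ρ : ℂ →+* ℂ).comp τ) with h3 | h3
        · exact h1 h3
        · exact hττ (hinjρ _ _ (h2.trans h3.symm))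
  rcases hk σ with rfl | rfl
  · rw [hρτ]
    by_cases hg : g.val % 2 = 0 <;> simp [hg]
  · rw [hρ2, hρτ]
    have hne : decide (ComplexEmbedding.conjugate τ = τ) = false := decide_eq_false hττ
    rw [hne]
    by_cases hg : g.val % 2 = 0 <;> simp [hg]

variable {Φ₂ : ∀ j : Fin 2, CMType (Kf (curveSlots₂ i₀ i₁ j))}
  (hΦ : ∀ s : Kf i₁ →+* ℂ, s ∈ (Φ₂ 0).1 ↔ (e s).val < 5)
  (hΨ : ∀ σ : Kf i₀ →+* ℂ, σ ∈ (Φ₂ (0 : Fin 1).succ).1 ↔ σ = τ)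

include hττ hk he_sign hΦ hΨ in
/-- **Membership read in the frame**: for a realiser `ρ` of `+g`, `ρ ∘ x ∈ Φ₂ ↔ act g (toPt x) ∈ phi`.
[cite: GaoUllmo2025, Thm 3.1 (3.2)] -/
theorem comp_mem_iff_act_mem_phi {ρ : ℂ ≃+* ℂ} {g : ZMod 10}
    (hρ : ∀ s : Kf i₁ →+* ℂ, e ((ρ : ℂ →+* ℂ).comp s) = e s + g)
    (x : (j : Fin 2) × (Kf (curveSlots₂ i₀ i₁ j) →+* ℂ)) :
    (ρ : ℂ →+* ℂ).comp x.2 ∈ (Φ₂ x.1).1 ↔ act g (toPt e τ x) ∈ phi := by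
  rcases sigma_cases x with ⟨s, rfl⟩ | ⟨σ, rfl⟩
  · change (ρ : ℂ →+* ℂ).comp s ∈ (Φ₂ 0).1 ↔ _
    rw [hΦ, hρ, toPt_zero, act_inr, mem_phi_inr]
  · change (ρ : ℂ →+* ℂ).comp σ ∈ (Φ₂ (0 : Fin 1).succ).1 ↔ _
    rw [hΨ, toPt_one, act_inl, mem_phi_inl, comp_eq_iff_of_realises hττ hk he_sign ρ hρ σ]

variable {N : ℕ} (κ : Fin N → Fin 2)

include hττ hk he_sign he_gal hΦ hΨ in
/-- **FRAME TRANSFER FOR THE POWERS**: an `Aut(ℂ)`-balanced weight of `X = ⨁_j A₂(κ j)` (`IsGaloisBalancedAlg` for the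
CM algebra `∏_j K_{κ j}`, types `Φ₂ (κ j)`) is a balanced configuration of the 12-point model under `v = toPt e τ ∘ P`,
`P (j, s) = (κ j, s)` (the ten translations are realised by automorphisms of `ℂ`). [cite: GaoUllmo2025, Thm 3.1 (3.2)] -/
theorem modelBalanced_of_isGaloisBalancedAlg {S : Finset ((j : Fin N) × (Kf (curveSlots₂ i₀ i₁ (κ j)) →+* ℂ))}
    (hS : IsGaloisBalancedAlg (K := fun j => Kf (curveSlots₂ i₀ i₁ (κ j))) (fun j => Φ₂ (κ j)) S) :
    ModelBalanced (fun x => toPt e τ ((Sigma.map κ (fun _ => id) :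
      ((j : Fin N) × (Kf (curveSlots₂ i₀ i₁ (κ j)) →+* ℂ)) → ((m : Fin 2) × (Kf (curveSlots₂ i₀ i₁ m) →+* ℂ))) x)) S := by
  intro g
  obtain ⟨ρ, hρ⟩ := he_gal g
  have h := hS ρ
  rw [ncard_sep_eq_card_filter, ncard_sep_eq_card_filter] at h
  have key : ∀ x : (j : Fin N) × (Kf (curveSlots₂ i₀ i₁ (κ j)) →+* ℂ),
      (ρ : ℂ →+* ℂ).comp x.2 ∈ (Φ₂ (κ x.1)).1 ↔ act g (toPt e τ ((Sigma.map κ (fun _ => id) :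
        ((j : Fin N) × (Kf (curveSlots₂ i₀ i₁ (κ j)) →+* ℂ)) → ((m : Fin 2) × (Kf (curveSlots₂ i₀ i₁ m) →+* ℂ))) x))
          ∈ phi :=
    fun x => comp_mem_iff_act_mem_phi hττ hk he_sign hΦ hΨ hρ ⟨κ x.1, x.2⟩
  rw [Finset.filter_congr fun x _ => key x, Finset.filter_congr fun x _ => (key x).not] at h
  exact h

omit [∀ i, Field (Kf i)] in
/-- Complex conjugation on the fivefold slot of the index set. [folklore] -/
theorem conj_smul_zero [∀ i, Field (Kf i)] (s : Kf i₁ →+* ℂ) :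
    (starRingAut : ℂ ≃+* ℂ) • (⟨0, s⟩ : (j : Fin 2) × (Kf (curveSlots₂ i₀ i₁ j) →+* ℂ)) =
      ⟨0, (ComplexEmbedding.conjugate s : Kf i₁ →+* ℂ)⟩ :=
  Sigma.ext rfl (heq_of_eq (RingHom.ext fun _ => rfl))

omit [∀ i, Field (Kf i)] in
/-- Complex conjugation on the curve slot of the index set. [folklore] -/
theorem conj_smul_one [∀ i, Field (Kf i)] (σ : Kf i₀ →+* ℂ) :
    (starRingAut : ℂ ≃+* ℂ) • (⟨(0 : Fin 1).succ, σ⟩ : (j : Fin 2) × (Kf (curveSlots₂ i₀ i₁ j) →+* ℂ)) =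
      ⟨(0 : Fin 1).succ, (ComplexEmbedding.conjugate σ : Kf i₀ →+* ℂ)⟩ :=
  Sigma.ext rfl (heq_of_eq (RingHom.ext fun _ => rfl))

include he_conj hττ hk in
/-- Conjugation is read in the model: `toPt (x̄) = c · toPt x`, `c = act 5`. [folklore] -/
theorem toPt_conj_smul (x : (j : Fin 2) × (Kf (curveSlots₂ i₀ i₁ j) →+* ℂ)) :
    toPt e τ ((starRingAut : ℂ ≃+* ℂ) • x) = act 5 (toPt e τ x) := by
  rcases sigma_cases x with ⟨s, rfl⟩ | ⟨σ, rfl⟩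
  · rw [conj_smul_zero, toPt_zero, toPt_zero, act_inr, he_conj]
  · have key : decide (ComplexEmbedding.conjugate σ = τ) = !decide (σ = τ) := by
      rcases hk σ with rfl | rfl
      · rw [decide_eq_false hττ]; simp
      · rw [ComplexEmbedding.involutive_conjugate, decide_eq_false hττ]; simp
    rw [conj_smul_one, toPt_one, toPt_one, act_five_inl, key]

end Transfer

/-! ## §2 The generating weights of `Y = B₀ × E` have algebraic lines -/

section Generators

variable {I : Type} {Kf : I → Type} [∀ i, Field (Kf i)] [∀ i, NumberField (Kf i)] [∀ i, IsCMField (Kf i)]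
  {i₀ i₁ : I} {e : (Kf i₁ →+* ℂ) ≃ ZMod 10} {τ : Kf i₀ →+* ℂ} {i : Kf i₀ →+* Kf i₁}
  (hττ : ComplexEmbedding.conjugate τ ≠ τ) (hk : ∀ σ : Kf i₀ →+* ℂ, σ = τ ∨ σ = ComplexEmbedding.conjugate τ)
  (he_sign : ∀ s : Kf i₁ →+* ℂ, s.comp i = τ ↔ (e s).val % 2 = 1)
  (he_conj : ∀ s : Kf i₁ →+* ℂ, e (ComplexEmbedding.conjugate s) = e s + 5)
  {A₂ : Fin 2 → AbelianVariety ℂ} {Φ₂ : ∀ j : Fin 2, CMType (Kf (curveSlots₂ i₀ i₁ j))}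
  {ι₂ : ∀ j, 𝓞 (Kf (curveSlots₂ i₀ i₁ j)) →+* End (A₂ j)}
  {θ₂ : ∀ j, Kf (curveSlots₂ i₀ i₁ j) →+* Module.End ℂ (complexBetti (A₂ j).X 1)}
  (hA : ∀ j, IsCMTypeRealisation (Φ₂ j) (A₂ j) (ι₂ j) (θ₂ j))

include hττ hk he_conj hA in
/-- A weight whose model image is a conjugate pair is a conjugate pair, so its line is algebraic (a divisor class).
[cite: Gordon1999HodgeAVSurvey, 9.2.2] -/
theorem weightClassesAlg_le_algebraicClasses_of_image_eq_conjPair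
    {T : Finset ((j : Fin 2) × (Kf (curveSlots₂ i₀ i₁ j) →+* ℂ))} {y : Pt} (hT : T.image (toPt e τ) = conjPair y) :
    T.card = 2 ∧ weightClassesAlg A₂ ι₂ (2 * 1) T ≤ algebraicClasses (⨁ A₂).X 1 := by
  have hinj := toPt_injective (e := e) hττ hk (i₁ := i₁)
  have hcard : T.card = 2 := by
    rw [← Finset.card_image_of_injective T hinj, hT]
    exact (gens_balanced.1 y).2
  refine ⟨hcard, weightClassesAlg_le_algebraicClasses_of_conj_smul_mem hA (m := 1) hcard fun x hx => ?_⟩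
  have hx' : toPt e τ x ∈ conjPair y := hT ▸ Finset.mem_image_of_mem _ hx
  have hcx : toPt e τ ((starRingAut : ℂ ≃+* ℂ) • x) ∈ T.image (toPt e τ) := by
    rw [toPt_conj_smul hττ hk he_conj x, hT, mem_conjPair_iff] at *
    rcases hx' with h | h
    · exact Or.inr (by rw [h])
    · exact Or.inl (by rw [h, isCMType_phi.2.1])
  exact (hinj.mem_finset_image).1 hcx

omit [∀ i, NumberField (Kf i)] [∀ i, IsCMField (Kf i)] in
include hττ hk he_sign in
/-- **The `weil6` lines lie in the Weil plane of the sixfold, hence are algebraic GIVEN that plane is**: a weight `T`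
of `Y = ⨁ A₂` with model image `weil6 b` has all its six points in the fibre of `τ` (`b = true`) resp. `τ̄`
(`b = false`), so every point has eigenvalue `±i√d` on the family `a = (iδ, δ)` and `H⁶(Y)_T ⊆ E±(⨁ A₂, ⊕_j ι_j(a_j))`
(`PairWeights.weightClassesAlg_le_weilClassesPlus/Minus`), inside `W_k ⊗ ℂ`; the hypothesis `hW` on the Weil plane of
`(A₂ 0 × A₂ 1, ι₀(iδ) × ι₁(δ))` is transported to `⨁ A₂` by `PairWeights.weilClassesOf_biproduct_le_algebraicClasses_of_prod`.
[cite: vanGeemen1994HodgeAV, 4.9 and proof of Thm. 6.12] [cite: Deligne1982HodgeCycles, §5 (c)] -/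
theorem weightClassesAlg_le_algebraicClasses_of_image_eq_weil6
    {δ : 𝓞 (Kf i₀)} {d : ℕ} (hτ : τ (δ : Kf i₀) = Complex.I * (Real.sqrt d : ℂ))
    (hW : weilClassesOf ((A₂ 0).prod (A₂ 1))
      (AbelianVariety.prodLift (AbelianVariety.fst (A₂ 0) (A₂ 1) ≫ ι₂ 0 (RingOfIntegers.mapRingHom i δ))
        (AbelianVariety.snd (A₂ 0) (A₂ 1) ≫ ι₂ 1 δ)) 3 d ≤
      algebraicClasses ((A₂ 0).prod (A₂ 1)).X 3)
    (b : Bool) (T : Finset ((j : Fin 2) × (Kf (curveSlots₂ i₀ i₁ j) →+* ℂ))) (hT : T.image (toPt e τ) = weil6 b) :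
    weightClassesAlg A₂ ι₂ (2 * 3) T ≤ algebraicClasses (⨁ A₂).X 3 := by
  have hconjτ : ComplexEmbedding.conjugate τ (δ : Kf i₀) = -(Complex.I * (Real.sqrt d : ℂ)) := by
    rw [ComplexEmbedding.conjugate_coe_eq, hτ, map_mul, Complex.conj_I, Complex.conj_ofReal, neg_mul]
  have hTcard : T.card = 2 * 3 := by
    rw [← Finset.card_image_of_injective T (toPt_injective hττ hk), hT]
    exact (gens_balanced.2 b).2.1
  -- the family `a = (iδ, δ)` on the two slots
  let a : ∀ j : Fin 2, 𝓞 (Kf (curveSlots₂ i₀ i₁ j)) := Fin.cons (RingOfIntegers.mapRingHom i δ) fun _ : Fin 1 => δ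
  -- eigenvalues on the points of `T`
  have hval : ∀ z ∈ T, z.2 ((a z.1 : 𝓞 (Kf (curveSlots₂ i₀ i₁ z.1))) : Kf (curveSlots₂ i₀ i₁ z.1)) =
      if b then Complex.I * (Real.sqrt d : ℂ) else -(Complex.I * (Real.sqrt d : ℂ)) := by
    intro z hz
    have hx' : toPt e τ z ∈ weil6 b := hT ▸ Finset.mem_image_of_mem _ hz
    rcases sigma_cases z with ⟨s, rfl⟩ | ⟨σ, rfl⟩
    · -- the fivefold slot: parity `b`
      rw [toPt_zero] at hx'
      have hpar : ((e s).val % 2 = 1) ↔ b = true := by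
        cases b
        · rcases (mem_weil6_false_iff _).1 hx' with h | h | h | h | h | h
          · exact absurd h Sum.inr_ne_inl
          all_goals rw [Sum.inr_injective h]; decide
        · rcases (mem_weil6_true_iff _).1 hx' with h | h | h | h | h | h
          · exact absurd h Sum.inr_ne_inl
          all_goals rw [Sum.inr_injective h]; decide
      show s ((RingOfIntegers.mapRingHom i δ : 𝓞 (Kf i₁)) : Kf i₁) = _
      have hmap : ((RingOfIntegers.mapRingHom i δ : 𝓞 (Kf i₁)) : Kf i₁) = i (δ : Kf i₀) := rfl
      rw [hmap]
      change (s.comp i) (δ : Kf i₀) = _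
      cases b
      · rw [comp_eq_conjugate_of_even hk he_sign (fun h => Bool.false_ne_true (hpar.1 h))]
        exact hconjτ
      · rw [(he_sign s).2 (hpar.2 rfl)]
        exact hτ
    · -- the curve slot: the embedding of sign `b`
      rw [toPt_one] at hx'
      have hσb : decide (σ = τ) = b := by
        cases b
        · rcases (mem_weil6_false_iff _).1 hx' with h | h | h | h | h | h
          · exact Sum.inl_injective h
          all_goals exact absurd h Sum.inl_ne_inr
        · rcases (mem_weil6_true_iff _).1 hx' with h | h | h | h | h | h
          · exact Sum.inl_injective h
          all_goals exact absurd h Sum.inl_ne_inr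
      show σ (δ : Kf i₀) = _
      cases b
      · rw [(hk σ).resolve_left (of_decide_eq_false hσb)]
        exact hconjτ
      · rw [of_decide_eq_true hσb]
        exact hτ
  -- the Weil plane of `⨁ A₂`, algebraic by `hW`
  have hWeil : weilClassesOf (⨁ A₂) (biproduct.map fun j => ι₂ j (a j)) 3 d ≤ algebraicClasses (⨁ A₂).X 3 :=
    weilClassesOf_biproduct_le_algebraicClasses_of_prod (A := A₂) (fun j => ι₂ j (a j)) hW
  cases b
  · refine (weightClassesAlg_le_weilClassesMinus (K := fun j => Kf (curveSlots₂ i₀ i₁ j)) (A := A₂) (ι := ι₂) a hTcard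
      fun z hz => ?_).trans ((weilClassesMinus_le_weilClassesOf _ _ 3 d).trans hWeil)
    simpa using hval z hz
  · refine (weightClassesAlg_le_weilClassesPlus (K := fun j => Kf (curveSlots₂ i₀ i₁ j)) (A := A₂) (ι := ι₂) a hTcard
      fun z hz => ?_).trans ((weilClassesPlus_le_weilClassesOf _ _ 3 d).trans hWeil)
    simpa using hval z hz

end Generators

end Summit.HodgeConjecture.CorCM.DecicCurveFivefold

end
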